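import Literature.IUT.HodgeArakelov.TemperedThetaMonoids

/-!
# [IUTchII] Def 3.8: the naming record `TemperedThetaMonoids.Def38Frobenioids` is inhabited (NV-L6 wave)

S. Mochizuki, *Inter-universal Teichmüller theory II*, §3, Definition 3.8 (i)–(iii), kurims pp. 112–115
[cite: Mochizuki2012, Def 3.8 p.112].  abc-iut cell, layer L6, §F v1.18p «NV-L6 WAVE» (abc-iut-L6-lead), row
`NV-L6/TemperedThetaMonoids.Def38Frobenioids` (abc-iut-w5-d114's INHABITATION-CENSUS-L6-v3 §A: zero producers);
seat abc-iut-w5-d169 (gen 2).  PROOF-ONLY (no `def`/`structure`/`instance`): the witnesses are built inside the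
theorem terms.

WHAT IS WITNESSED, HONESTLY.  abc-iut-L6-t2's `Def38Frobenioids Frob Iso Iota Conj ValueProfile Label` is a
SLOT-ONLY NAMING RECORD (its own docstring: "a record of NAMED objects of an abstract type `Frob` of Frobenioids with
an abstract isomorphism relation, one field per printed object/isomorphism"; Remark 3.8.1 p. 115: "the simplest
approach is to resort to the original monoid-theoretic formulations") — every field is DATA, there is NO law
field.  Consequently the record is inhabited over EVERY Frobenioid formalism `(Frob, Iso)` with `Iso` reflexive as
soon as ONE object `F₀ : Frob` and a labelling `Conj → Iota` are given (`nonempty_of_refl`: all nine Frobenioid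
slots := `F₀`, all isomorphism slots := reflexivity), in particular over degenerate carriers
(`nonempty_degenerate`).  This certifies exactly what ADJUDICATION-SPEC §4 (iii) asks of an interface — it is not
empty — and at the same time records that the interface CONSTRAINS NOTHING: no theorem of the tree quantifies over
it (consumers at 2026-08-26T03:15Z: only the kernel-DAG abbreviations `N_IUTchII_Def3_8_i/ii/iii`, `N_IUTchII_Rmk3_8_1`
of `Summits/ABC/IUTFork/DAGL6r/v.lean`), so nothing downstream is vacuous or non-vacuous on its account.  The
GENUINE inhabitant — the `p_v`-adic Frobenioids `F_cns(M^Θ_*)`, `F^ι_env(M^Θ_*)`, `F_ξ(M^Θ_*)`, … attached "via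
[FrdII], Example 1.1, (ii)" to the pairs `G_v ↷ Ψ_cns`, `G_v ↷ Ψ^ι_env`, `G_v ↷ Ψ_ξ` of Props 3.1/3.3 and Cor 3.5 —
needs abc-iut-L1's [FrdII] Ex 1.1 (ii) constructor applied to abc-iut-L6-t2's `ThetaEnvData.constantPair` /
`splitThetaPair` (GroupTheoreticThetaMonoids); it is NOT built here (label: DEGENERATE / PARAMETRIC witnesses).
Nothing here takes a side on [IUTchIII] Cor 3.12; typed ≠ proved.
-/

namespace Literature.IUT.HodgeArakelov

namespace TemperedThetaMonoids

universe u v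

/-- **PARAMETRIC inhabitant of the Def 3.8 naming record**: over ANY type of Frobenioids `Frob` with a REFLEXIVE
isomorphism relation `Iso`, any object `F₀` and any labelling `Conj → Iota`, the constant record (every Frobenioid
slot `:= F₀`, every isomorphism slot `:=` reflexivity) inhabits `Def38Frobenioids` — the record has no law field,
so it constrains nothing (Rmk 3.8.1: "resort to the original monoid-theoretic formulations").
[cite: Mochizuki2012, Def 3.8 p.112] -/
theorem Def38Frobenioids.nonempty_of_refl {Frob : Type u} {Iso : Frob → Frob → Prop}
    (hrefl : ∀ F : Frob, Iso F F) (F₀ : Frob) {Iota Conj ValueProfile Label : Type v} (lab : Conj → Iota) :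
    Nonempty (Def38Frobenioids Frob Iso Iota Conj ValueProfile Label) :=
  ⟨{ Fcns := F₀
     FdagC := F₀
     kummerConstant := hrefl F₀
     FcnsMono := F₀
     FdagCMono := F₀
     kummerConstantMono := hrefl F₀
     Fenv := fun _ => F₀
     FdagTheta := fun _ => F₀
     Fgau := fun _ => F₀
     FFgau := fun _ => F₀
     label := lab
     evalIsoThetaEnv := fun _ => hrefl F₀
     evalIsoEnvGau := fun _ _ => hrefl F₀
     evalIsoGauF := fun _ => hrefl F₀
     gaussianDistribution := fun _ _ => F₀
     constantDistribution := fun _ => F₀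
     constantDistribution_iso := fun _ => hrefl F₀ }⟩

/-- **DEGENERATE inhabitant** (NV-L6 census row `TemperedThetaMonoids.Def38Frobenioids`): one-point type of
"Frobenioids", the total isomorphism relation, one-point index types.  Label: DEGENERATE (`Unit` carriers) — the
genuine inhabitant is the family of `p_v`-adic Frobenioids of Def 3.8 via [FrdII] Ex 1.1 (ii), not built here.
[cite: Mochizuki2012, Def 3.8 p.112] -/
theorem Def38Frobenioids.nonempty_degenerate :
    Nonempty (Def38Frobenioids PUnit.{u + 1} (fun _ _ => True) PUnit.{v + 1} PUnit.{v + 1} PUnit.{v + 1}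
      PUnit.{v + 1}) :=
  Def38Frobenioids.nonempty_of_refl (fun _ => trivial) PUnit.unit fun _ => PUnit.unit

/-- The record is inhabited over any INHABITED type of Frobenioids with `Eq` as isomorphism relation and any
labelling (the minimal non-degenerate reading of "isomorphism": equality). [cite: Mochizuki2012, Def 3.8 p.112] -/
theorem Def38Frobenioids.nonempty_of_inhabited {Frob : Type u} [Inhabited Frob]
    {Iota Conj ValueProfile Label : Type v} (lab : Conj → Iota) :
    Nonempty (Def38Frobenioids Frob (· = ·) Iota Conj ValueProfile Label) :=
  Def38Frobenioids.nonempty_of_refl (fun _ => rfl) default lab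

end TemperedThetaMonoids

end Literature.IUT.HodgeArakelov
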